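import Summits.BirchSwinnertonDyer.BirchSwinnertonDyer.Theorems.EisensteinPrimesSurLambdaCaseCTCOfPoitouTateAt
import Summits.BirchSwinnertonDyer.BirchSwinnertonDyer.Theorems.EisensteinPrimesPoitouTateShaNaturalAtTC
import HarnessLib

/-!
# Greenberg 2016 Prop. 2.6.3 (c) (= Greenberg 2010 Prop. 3.2.1 (c)) at totally complex `K` — the Literature named fact
# `Greenberg2016.prop263_sur_of_crk_caseC_tc` — DISCHARGED in the kernel: road «SUR-Λ» (cell `bsd-eis`) fed with the tree's END theorem
# of lane «PT-Ш-S-TC» (Milne ADT I Thm. 4.10 (a) at finite `S` over totally complex fields)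

Cell `bsd-schneider-ideate`, seat `bsd-schneider-door-c5` (prover, generation 41; `--supports` stmt-BirchSwinnertonDyer-19177, the K1 door's
crux r3 `GordTwoBranchIMC`, whose algebraic side at every odd prime consumes exactly this statement through cell `bsd-eis`'s `…_ofSurC` engines —
generation 40's F38a–F42).  PARTITION: board row B6 ∩ X3 ∩ sst-twist, `r = 1` of `Rank1Residual.partition` — INPUT LAYER (one named input of the
door's algebraic side becomes a tree theorem); types-the-object-of nothing new; closes none of B6's cells; «closes rung: none» (BSD NOT advanced).

WHAT.  `prop263_sur_of_crk_caseC_tc` (Literature/NumberTheory/IwasawaTheory/Greenberg2016/GlobalToLocalSurjectivity.lean) is the case-(c),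
totally-complex-`K` instance of Greenberg's global-to-local surjectivity proposition ([Gr16] Prop. 2.6.3 / [Gr10] Prop. 3.2.1): for `K` totally
complex, `Σ ⊇ {v ∣ p}` finite, `Λ ≅ ℤ_p⟦T_1,…,T_m⟧`, a cofree discrete `Λ`-adic `G_{K,Σ}`-representation `𝐃` with RFX, LEO, CRK(𝐃, 𝓛) and an
`η ∈ Σ` with LOC_η⁽¹⁾ and `Q_𝓛(K_η, 𝐃)` coreflexive, the global-to-local map `φ_𝓛` is surjective.  Cell `bsd-eis` proved it MODULO the natural
restricted Poitou–Tate `Ш`-duality at finite sets of places of totally complex fields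
(`SurLambda.prop263_sur_of_crk_caseC_tc_of_poitouTateNaturalAt`, seat bsd-line-x1-p1 gen 10), and then proved that duality itself from the tree's
`S`-idèle class formation (`PoitouTateShaNaturalAtTC.forall_poitouTate_shaRestricted_tateDual_natural_at_of_isTotallyComplex`, lane «PT-Ш-S-TC» END
theorem, 2026-08-29).  THIS FILE composes the two: `prop263_sur_of_crk_caseC_tc_holds`, NO hypothesis.

HONEST FRAMING: a composition of two tree theorems; it turns ONE named input (Greenberg 2016 Prop. 2.6.3 (c) at totally complex `K`) of the
Eisenstein-prime / K1-door algebraic sides into a kernel theorem.  No main conjecture, no case of BSD, no crux is proved by this file; AI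
formalisation, established only by the kernel check.

## References
* R. Greenberg, *On the structure of Selmer groups*, in: Elliptic Curves, Modular Forms and Iwasawa Theory, Springer Proc. Math. Stat. 188 (2016),
  225–252, Prop. 2.6.3 (c). [Greenberg2016Selmer]
* R. Greenberg, *Surjectivity of the global-to-local map defining a Selmer group*, Kyoto J. Math. 50 (2010) 853–888, Prop. 3.2.1 (c). [Greenberg2010]
* J. S. Milne, *Arithmetic Duality Theorems*, 2nd ed. (2006), I Thm. 4.10 (a). [MilneADT2006]
-/

set_option autoImplicit false
set_option linter.dupNamespace false -- the summit namespace `…BirchSwinnertonDyer.BirchSwinnertonDyer.Theorems` (Sub = Summit, D-0017) trips it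

noncomputable section

namespace Summit.BirchSwinnertonDyer.BirchSwinnertonDyer.Theorems.SurLambda

/-- **Greenberg 2016 Prop. 2.6.3 (c) / Greenberg 2010 Prop. 3.2.1 (c) at totally complex `K` — the named fact
`Greenberg2016.prop263_sur_of_crk_caseC_tc` HOLDS (no hypothesis)**: road «SUR-Λ»'s END-compose
`prop263_sur_of_crk_caseC_tc_of_poitouTateNaturalAt` fed with lane «PT-Ш-S-TC»'s END theorem
`PoitouTateShaNaturalAtTC.forall_poitouTate_shaRestricted_tateDual_natural_at_of_isTotallyComplex` (Milne ADT I Thm. 4.10 (a), natural form, at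
every finite set of places of a totally complex number field — a tree theorem).
[cite: Greenberg2016Selmer, Prop. 2.6.3 (c) (§2.6 p. 10 L13–22)] [cite: Greenberg2010, Prop. 3.2.1 (c) and proof (p. 15 L19–32)]
[cite: MilneADT2006, Ch. I, Thm. 4.10 (a) p. 57, §4 p. 65] -/
theorem prop263_sur_of_crk_caseC_tc_holds : Literature.NumberTheory.IwasawaTheory.Greenberg2016.prop263_sur_of_crk_caseC_tc :=
  prop263_sur_of_crk_caseC_tc_of_poitouTateNaturalAt
    PoitouTateShaNaturalAtTC.forall_poitouTate_shaRestricted_tateDual_natural_at_of_isTotallyComplex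

end Summit.BirchSwinnertonDyer.BirchSwinnertonDyer.Theorems.SurLambda

end
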